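import Summits.KontsevichZagierPeriods.KontsevichZagierPeriods.Theses.CarlsonRule
import Literature.NumberTheory.Transcendental.KZKernelConjectureForms
import Literature.NumberTheory.Transcendental.KZCalculusProofs
import Literature.NumberTheory.Transcendental.KZUnfolding

/-!
# Crux attack, second seat (g2), on `CarlsonRule.CarlsonKernel` (stmt-KontsevichZagierPeriods-14426)

Refuter one-shot, crux-attack mode.  The first seat's file `Cruxes/CarlsonKernel/Attack.lean`
(re-checked from the tree today: rc 0, 0 sorry, axioms {propext, Classical.choice, Quot.sound})
proved value-level soundness of the typed rule and the sandwich
`relations ≤ carlsonClosure ≤ ker eval`, `KontsevichZagierPeriods ↔ CarlsonClosure ∧ CarlsonKernel`.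
This file adds the RESTATES-THE-TARGET check in exact form, kernel-checked:

* §1 vocabulary (verbatim closure hypothesis, the Carlson closure `carlsonClosure`,
  `CarlsonKernel ↔ ker eval ≤ carlsonClosure`) — restated here because `Cruxes/` modules are not
  importable on the farm.
* §2 **crux #3 and crux #6 are the two halves of one sandwich**:
  `CarlsonClosure ↔ carlsonClosure = relations` (`carlsonClosure_iff_eq_relations`) — the rule adds
  NOTHING to the four moves — while `CarlsonKernel ↔ ker eval ≤ carlsonClosure`.
* §3 **the crux is the summit statement for the enlarged calculus, in the summit's own printed
  shape**: `CarlsonKernel ↔ KZCPeriodConjecture`, where `KZCPeriodConjecture` is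
  `Literature.Periods.KZPeriodConjecture` (= the summit, `Iff.rfl`) with `KZ.Equivalent`
  replaced by KZ^C-equivalence `[r] − [r'] ∈ carlsonClosure`; also the algebraic-endpoint form and
  the single-representation form `∀ r, r.value = 0 → [r] ∈ carlsonClosure` (the exact kill shape:
  ONE absolutely convergent semialgebraic integral of value 0 that the five-rule calculus cannot
  reduce to `0`).
* §4 **under the route's own crux #3 the crux is LITERALLY the summit**:
  `CarlsonClosure → (CarlsonKernel ↔ KontsevichZagierPeriods)`; unconditionally
  `KontsevichZagierPeriods → CarlsonKernel`, so `¬ CarlsonKernel → ¬ KontsevichZagierPeriods`.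
  Verdict of the restates-target check: not verbatim (it is Conjecture 1 for KZ^C = KZ + Carlson's
  rule, a priori weaker), but summit-strength, and verbatim as soon as crux #3 lands.

Classification: SURVIVES (conjecture-grade; a refutation is a disproof of the formal summit).
-/

noncomputable section

set_option linter.dupNamespace false

open MeasureTheory Set
open Literature.NumberTheory.Transcendental

namespace Summit.KontsevichZagierPeriods.KontsevichZagierPeriods.Cruxes.CarlsonKernel.AttackG2

open Summit.KontsevichZagierPeriods.KontsevichZagierPeriods.Theses.CarlsonRule
  (CarlsonKernel CarlsonClosure CarlsonSound)

variable {n m : ℕ}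

/-! ## §1 Vocabulary (as in the first seat's file) -/

/-- `R` is closed under Carlson's rule — the closure hypothesis of the crux, verbatim. [folklore] -/
def ClosedUnderCarlson (R : AddSubgroup KZ.FormalRep) : Prop :=
  ∀ (n n' : ℕ) (σ : Set (Fin n → ℝ)) (τ : Set (Fin n' → ℝ)) (f g : (Fin n → ℝ) → ℝ)
    (f' g' : (Fin n' → ℝ) → ℝ) (M : ℝ) (r : ℕ → KZ.IntegralRep n) (s : ℕ → KZ.IntegralRep n'),
    (∀ x ∈ σ, 0 ≤ g x ∧ g x ≤ M) → (∀ y ∈ τ, 0 ≤ g' y ∧ g' y ≤ M) →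
    (∀ m, (r m).domain = σ ∧ Set.EqOn (r m).integrand (fun x => f x * g x ^ m) σ) →
    (∀ m, (s m).domain = τ ∧ Set.EqOn (s m).integrand (fun y => f' y * g' y ^ m) τ) →
    (∀ m, KZ.of (r m) - KZ.of (s m) ∈ R) →
    ∀ (k : ℚ), 0 ≤ k → ∀ (rk : KZ.IntegralRep n) (sk : KZ.IntegralRep n'),
      rk.domain = σ → Set.EqOn rk.integrand (fun x => f x * g x ^ (k : ℝ)) σ →
      sk.domain = τ → Set.EqOn sk.integrand (fun y => f' y * g' y ^ (k : ℝ)) τ →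
      KZ.of rk - KZ.of sk ∈ R

/-- The crux, unfolded. [folklore] -/
theorem carlsonKernel_iff :
    CarlsonKernel ↔ ∀ R : AddSubgroup KZ.FormalRep, KZ.relations ≤ R → ClosedUnderCarlson R →
      ∀ c : KZ.FormalRep, KZ.eval c = 0 → c ∈ R :=
  Iff.rfl

/-- Crux #3 of the route: `relations` itself is Carlson-closed. [folklore] -/
theorem carlsonClosure_iff : CarlsonClosure ↔ ClosedUnderCarlson KZ.relations := Iff.rfl

/-- The Carlson closure of the four moves: the relation group of the calculus KZ^C. [folklore] -/
def carlsonClosure : AddSubgroup KZ.FormalRep :=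
  sInf {R | KZ.relations ≤ R ∧ ClosedUnderCarlson R}

/-- ω-rules with premisses in `R` are preserved by intersections. [folklore] -/
theorem closedUnderCarlson_sInf (S : Set (AddSubgroup KZ.FormalRep))
    (hS : ∀ R ∈ S, ClosedUnderCarlson R) : ClosedUnderCarlson (sInf S) := by
  intro n n' σ τ f g f' g' M r s hg hg' hr hs hR k hk rk sk h1 h2 h3 h4
  rw [AddSubgroup.mem_sInf]
  intro R hRS
  exact hS R hRS n n' σ τ f g f' g' M r s hg hg' hr hs
    (fun m => (AddSubgroup.mem_sInf.1 (hR m)) R hRS) k hk rk sk h1 h2 h3 h4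

/-- `carlsonClosure` is Carlson-closed. [folklore] -/
theorem closedUnderCarlson_carlsonClosure : ClosedUnderCarlson carlsonClosure :=
  closedUnderCarlson_sInf _ fun _ hR => hR.2

/-- `relations ≤ carlsonClosure`. [folklore] -/
theorem relations_le_carlsonClosure : KZ.relations ≤ carlsonClosure :=
  le_sInf fun _ hR => hR.1

/-- Minimality of `carlsonClosure`. [folklore] -/
theorem carlsonClosure_le {R : AddSubgroup KZ.FormalRep} (h1 : KZ.relations ≤ R)
    (h2 : ClosedUnderCarlson R) : carlsonClosure ≤ R :=
  sInf_le ⟨h1, h2⟩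

/-- **Crux #6 says exactly `ker eval ≤ carlsonClosure`.** [folklore] -/
theorem carlsonKernel_iff_ker_le : CarlsonKernel ↔ KZ.eval.ker ≤ carlsonClosure := by
  rw [carlsonKernel_iff]
  constructor
  · intro h c hc
    exact h _ relations_le_carlsonClosure closedUnderCarlson_carlsonClosure c
      ((AddMonoidHom.mem_ker).1 hc)
  · intro h R h1 h2 c hc
    exact carlsonClosure_le h1 h2 (h ((AddMonoidHom.mem_ker).2 hc))

/-! ## §2 Crux #3 says exactly `carlsonClosure = relations` -/

/-- **Crux #3 is the statement that Carlson's rule enlarges nothing**: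
`CarlsonClosure ↔ carlsonClosure = relations`. [folklore] -/
theorem carlsonClosure_iff_eq_relations : CarlsonClosure ↔ carlsonClosure = KZ.relations := by
  constructor
  · intro h
    exact le_antisymm (carlsonClosure_le le_rfl (carlsonClosure_iff.1 h)) relations_le_carlsonClosure
  · intro h
    have hc := closedUnderCarlson_carlsonClosure
    rw [h] at hc
    exact carlsonClosure_iff.2 hc

/-- The summit in kernel form says exactly `ker eval ≤ relations`. [folklore] -/
theorem summit_iff_ker_le : KontsevichZagierPeriods ↔ KZ.eval.ker ≤ KZ.relations := by
  rw [show KontsevichZagierPeriods ↔ KZKernelConjecture from kzKernelConjecture_iff_isRational.symm]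
  constructor
  · intro h c hc
    exact h c ((AddMonoidHom.mem_ker).1 hc)
  · intro h c hc
    exact h ((AddMonoidHom.mem_ker).2 hc)

/-- `relations ≤ ker eval` (tree theorem: the four moves are sound). [folklore] -/
theorem relations_le_ker : KZ.relations ≤ KZ.eval.ker := KZ.relations_le_ker_eval_holds

/-! ## §3 Two-representation and single-representation forms of the crux -/

/-- KZ^C-equivalence of two representations: `[r] − [r'] ∈ carlsonClosure`. [folklore] -/
def CEquivalent (r : KZ.IntegralRep n) (r' : KZ.IntegralRep m) : Prop :=
  KZ.of r - KZ.of r' ∈ carlsonClosure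

/-- KZ-equivalent representations are KZ^C-equivalent. [folklore] -/
theorem cEquivalent_of_equivalent {r : KZ.IntegralRep n} {r' : KZ.IntegralRep m}
    (h : KZ.Equivalent r r') : CEquivalent r r' :=
  relations_le_carlsonClosure h

/-- The summit statement `Literature.Periods.KZPeriodConjecture` with `KZ.Equivalent` replaced by
KZ^C-equivalence — "Conjecture 1 for the calculus KZ^C" in the printed two-representation shape.
[folklore] -/
def KZCPeriodConjecture : Prop :=
  ∀ ⦃n m : ℕ⦄ (r : KZ.IntegralRep n) (r' : KZ.IntegralRep m),
    r.IsRational → r'.IsRational → r.value = r'.value → CEquivalent r r'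

/-- For comparison, the summit is the same text over `KZ.Equivalent` (`Iff.rfl`). [folklore] -/
theorem summit_iff_twoRep :
    KontsevichZagierPeriods ↔
      ∀ ⦃n m : ℕ⦄ (r : KZ.IntegralRep n) (r' : KZ.IntegralRep m),
        r.IsRational → r'.IsRational → r.value = r'.value → KZ.Equivalent r r' :=
  Iff.rfl

/-- **The crux in algebraic-endpoint two-representation form**: any two representations with the
same value are KZ^C-equivalent. [folklore] -/
theorem carlsonKernel_iff_twoRep :
    CarlsonKernel ↔ ∀ ⦃n m : ℕ⦄ (r : KZ.IntegralRep n) (r' : KZ.IntegralRep m),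
      r.value = r'.value → CEquivalent r r' := by
  rw [carlsonKernel_iff_ker_le]
  constructor
  · intro h n m r r' hv
    apply h
    rw [AddMonoidHom.mem_ker, KZ.eval_of_sub_of, hv, sub_self]
  · intro h c hc
    obtain ⟨n, m, r, r', hrel⟩ := KZ.exists_integralRep_sub_holds c
    have hker : KZ.eval (c - (KZ.of r - KZ.of r')) = 0 := KZ.relations_le_ker_eval_holds hrel
    rw [map_sub, (AddMonoidHom.mem_ker).1 hc, zero_sub, neg_eq_zero, KZ.eval_of_sub_of,
      sub_eq_zero] at hker
    have hE : CEquivalent r r' := h r r' hker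
    have := carlsonClosure.add_mem (relations_le_carlsonClosure hrel) hE
    simpa using this

/-- **The crux is `KZCPeriodConjecture`** — the summit text for the enlarged calculus (rational
endpoints reached through `KZ.exists_isRational_equivalent`). [folklore] -/
theorem carlsonKernel_iff_kzcPeriodConjecture : CarlsonKernel ↔ KZCPeriodConjecture := by
  rw [carlsonKernel_iff_twoRep]
  constructor
  · intro h n m r r' _ _ hv
    exact h r r' hv
  · intro h n m r r' hv
    obtain ⟨N, R, hR, hrR⟩ := KZ.exists_isRational_equivalent_holds r
    obtain ⟨N', R', hR', hrR'⟩ := KZ.exists_isRational_equivalent_holds r'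
    have hvR : R.value = R'.value := by
      rw [← KZ.Equivalent.value_eq_holds hrR, ← KZ.Equivalent.value_eq_holds hrR', hv]
    have h1 : CEquivalent r R := cEquivalent_of_equivalent hrR
    have h2 : CEquivalent R R' := h R R' hR hR' hvR
    have h3 : CEquivalent R' r' := cEquivalent_of_equivalent hrR'.symm
    have e : KZ.of r - KZ.of r' = (KZ.of r - KZ.of R) + (KZ.of R - KZ.of R') + (KZ.of R' - KZ.of r') := by
      abel
    show KZ.of r - KZ.of r' ∈ carlsonClosure
    rw [e]
    exact carlsonClosure.add_mem (carlsonClosure.add_mem h1 h2) h3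

/-- **Single-representation form (the exact kill shape)**: the crux holds iff every absolutely
convergent `ℚ`-semialgebraic integral of value `0` is reduced to `0` by the five-rule calculus.
[folklore] -/
theorem carlsonKernel_iff_single :
    CarlsonKernel ↔ ∀ ⦃n : ℕ⦄ (r : KZ.IntegralRep n), r.value = 0 → KZ.of r ∈ carlsonClosure := by
  rw [carlsonKernel_iff_ker_le]
  constructor
  · intro h n r hv
    apply h
    rw [AddMonoidHom.mem_ker, KZ.eval_of, hv]
  · intro h c hc
    obtain ⟨n, m, r, r', hrel⟩ := KZ.exists_integralRep_sub_holds c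
    obtain ⟨N, R, hR⟩ := r.exists_of_add_of_sub_of_mem_relations r'.neg
    have hneg : KZ.of r' + KZ.of r'.neg ∈ KZ.relations :=
      KZ.levelRel_le_relations (KZ.of_add_of_neg_mem_levelRel r')
    have hcR : c - KZ.of R ∈ KZ.relations := by
      have e : c - KZ.of R = (c - (KZ.of r - KZ.of r')) - (KZ.of r' + KZ.of r'.neg) +
          (KZ.of r + KZ.of r'.neg - KZ.of R) := by
        abel
      rw [e]
      exact KZ.relations.add_mem (KZ.relations.sub_mem hrel hneg) hR
    have hval : R.value = 0 := by
      have h0 : KZ.eval (c - KZ.of R) = 0 := KZ.relations_le_ker_eval_holds hcR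
      rwa [map_sub, (AddMonoidHom.mem_ker).1 hc, zero_sub, neg_eq_zero, KZ.eval_of] at h0
    have e : c = (c - KZ.of R) + KZ.of R := by abel
    rw [e]
    exact carlsonClosure.add_mem (relations_le_carlsonClosure hcR) (h R hval)

/-- Correspondingly, **a kill is ONE representation**: `¬ CarlsonKernel` iff some absolutely
convergent semialgebraic integral of value `0` lies outside the Carlson closure of the moves.
[folklore] -/
theorem not_carlsonKernel_iff_single :
    ¬ CarlsonKernel ↔ ∃ (n : ℕ) (r : KZ.IntegralRep n), r.value = 0 ∧ KZ.of r ∉ carlsonClosure := by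
  rw [carlsonKernel_iff_single]
  push Not
  rfl

/-! ## §4 The restates-the-target verdict -/

/-- The summit implies the crux (the closure hypothesis is not even used). [folklore] -/
theorem carlsonKernel_of_summit (h : KontsevichZagierPeriods) : CarlsonKernel := by
  rw [carlsonKernel_iff_ker_le]
  exact (summit_iff_ker_le.1 h).trans relations_le_carlsonClosure

/-- What a kill costs: `¬ CarlsonKernel → ¬ KontsevichZagierPeriods`. [folklore] -/
theorem not_summit_of_not_carlsonKernel (h : ¬ CarlsonKernel) : ¬ KontsevichZagierPeriods :=
  fun hs => h (carlsonKernel_of_summit hs)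

/-- **Under the route's own crux #3, crux #6 is literally the summit.** [folklore] -/
theorem carlsonKernel_iff_summit_of_carlsonClosure (h : CarlsonClosure) :
    CarlsonKernel ↔ KontsevichZagierPeriods := by
  rw [carlsonKernel_iff_ker_le, carlsonClosure_iff_eq_relations.1 h, summit_iff_ker_le]

/-- The route's deciding theorem, recovered: `CarlsonClosure → CarlsonKernel → summit`. [folklore] -/
theorem closes' : CarlsonClosure → CarlsonKernel → KontsevichZagierPeriods :=
  fun h₁ h₂ => (carlsonKernel_iff_summit_of_carlsonClosure h₁).1 h₂

/-- **Summary of the sandwich** `relations ≤ carlsonClosure`, `relations ≤ ker eval`, with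
crux #3 = "left equality", crux #6 = "`ker eval` below the middle", summit = "`ker eval ≤ relations`".
[folklore] -/
theorem sandwich :
    KZ.relations ≤ carlsonClosure ∧ KZ.relations ≤ KZ.eval.ker ∧
    (CarlsonClosure ↔ carlsonClosure = KZ.relations) ∧
    (CarlsonKernel ↔ KZ.eval.ker ≤ carlsonClosure) ∧
    (KontsevichZagierPeriods ↔ KZ.eval.ker ≤ KZ.relations) ∧
    (CarlsonKernel ↔ KZCPeriodConjecture) :=
  ⟨relations_le_carlsonClosure, relations_le_ker, carlsonClosure_iff_eq_relations,
    carlsonKernel_iff_ker_le, summit_iff_ker_le, carlsonKernel_iff_kzcPeriodConjecture⟩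

end Summit.KontsevichZagierPeriods.KontsevichZagierPeriods.Cruxes.CarlsonKernel.AttackG2
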